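import Mathlib.Geometry.Manifold.ContMDiff.Atlas
import Mathlib.Geometry.Manifold.ContMDiff.NormedSpace
import Mathlib.Analysis.SpecialFunctions.SmoothTransition
import Mathlib.Analysis.Convex.PathConnected
import HarnessLib

/-!
# Smooth paths in connected open subsets of a manifold

Topic `Literature/Topology/FourManifolds` (fact seat
`provefact-Literature.Topology.FourManifolds.Cobordism.Milnor1965_exists_circle_transverse_rightHandSphere`,
Milnor's Lemma 8.3: *"Since `V` is connected [...] these points may be joined by a smooth path
in `V` which avoids the left hand 0-spheres"*).  The elementary fact used there and throughout
differential topology: two points of a connected open subset `O` of a `C^∞` manifold are joined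
by a **smooth** path inside `O`; we produce paths `p : ℝ → M` which are constant for `t ≤ 0`
and for `t ≥ 1` (so that paths concatenate smoothly and can be inserted into other smooth
constructions without matching derivatives).

* `Literature.Topology.FourManifolds.SmoothlyJoinedIn I O x y` — the relation;
  `refl`, `symm`, `trans`;
* `Literature.Topology.FourManifolds.SmoothlyJoinedIn.of_mem_extChartAt_ball` — the local
  case: straight segments in a chart ball, reparametrised by `Real.smoothTransition`
  (the model `range I` is convex, corners allowed);
* **proved**: `Literature.Topology.FourManifolds.smoothlyJoinedIn_of_isPreconnected` — any two
  points of a preconnected open set `O` are smoothly joined in `O` (the classes of the relation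
  are open, `O` is preconnected).

Everything here is proved (folklore; e.g. the argument of Milnor, *Topology from the
differentiable viewpoint* (1965), §4, Homogeneity Lemma, or Lee, *Introduction to Smooth
Manifolds*, 2nd ed., proof of Thm. 6.26 / Prop. 1.11 with Whitney approximation replaced by the
chart-by-chart construction).  No named facts, no new instances.
-/

open scoped Manifold ContDiff Topology
open Set Function Filter Metric

noncomputable section

namespace Literature.Topology.FourManifolds

universe u

section SmoothPaths

variable {E : Type*} [NormedAddCommGroup E] [NormedSpace ℝ E] {H : Type*} [TopologicalSpace H]
  (I : ModelWithCorners ℝ E H) {M : Type u} [TopologicalSpace M] [ChartedSpace H M]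

/-- **Smoothly joined points.**  `SmoothlyJoinedIn I O x y`: there is a `C^∞` map `p : ℝ → M`
with `p t = x` for `t ≤ 0`, `p t = y` for `1 ≤ t`, and `p t ∈ O` for every `t` — a smooth path
from `x` to `y` inside `O`, constant near (and beyond) its ends. [folklore] -/
def SmoothlyJoinedIn (O : Set M) (x y : M) : Prop :=
  ∃ p : ℝ → M, ContMDiff 𝓘(ℝ, ℝ) I ∞ p ∧ (∀ t ≤ (0 : ℝ), p t = x) ∧ (∀ t, (1 : ℝ) ≤ t → p t = y) ∧
    ∀ t, p t ∈ O

variable {I} {O : Set M} {x y z : M}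

namespace SmoothlyJoinedIn

/-- The endpoints of a smooth path in `O` lie in `O`. [folklore] -/
theorem mem_left (h : SmoothlyJoinedIn I O x y) : x ∈ O := by
  obtain ⟨p, -, h0, -, hO⟩ := h
  rw [← h0 0 le_rfl]; exact hO 0

/-- The endpoints of a smooth path in `O` lie in `O`. [folklore] -/
theorem mem_right (h : SmoothlyJoinedIn I O x y) : y ∈ O := by
  obtain ⟨p, -, -, h1, hO⟩ := h
  rw [← h1 1 le_rfl]; exact hO 1

/-- The relation is monotone in the set. [folklore] -/
theorem mono {O' : Set M} (h : SmoothlyJoinedIn I O x y) (hOO' : O ⊆ O') : SmoothlyJoinedIn I O' x y := by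
  obtain ⟨p, hp, h0, h1, hO⟩ := h
  exact ⟨p, hp, h0, h1, fun t => hOO' (hO t)⟩

/-- Reflexivity: the constant path. [folklore] -/
theorem refl (hx : x ∈ O) : SmoothlyJoinedIn I O x x :=
  ⟨fun _ => x, contMDiff_const, fun _ _ => rfl, fun _ _ => rfl, fun _ => hx⟩

/-- Symmetry: reverse the path, `t ↦ p (1 - t)`. [folklore] -/
theorem symm (h : SmoothlyJoinedIn I O x y) : SmoothlyJoinedIn I O y x := by
  obtain ⟨p, hp, h0, h1, hO⟩ := h
  refine ⟨fun t => p (1 - t), hp.comp (contDiff_const.sub contDiff_id).contMDiff, fun t ht => ?_,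
    fun t ht => ?_, fun t => hO _⟩
  · exact h1 _ (by linarith)
  · exact h0 _ (by linarith)

/-- Transitivity: run the first path at triple speed on `[0, 1/3]`, rest at `y` on `[1/3, 2/3]`,
then the second path on `[2/3, 1]`; the concatenation is smooth because both pieces are constant
on the open overlap `(1/3, 2/3)`. [folklore] -/
theorem trans (h₁ : SmoothlyJoinedIn I O x y) (h₂ : SmoothlyJoinedIn I O y z) :
    SmoothlyJoinedIn I O x z := by
  obtain ⟨p, hp, hp0, hp1, hpO⟩ := h₁
  obtain ⟨q, hq, hq0, hq1, hqO⟩ := h₂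
  classical
  set r : ℝ → M := fun t => if t ≤ 1 / 2 then p (3 * t) else q (3 * t - 2) with hr
  have hleft : ∀ t < (2 : ℝ) / 3, r t = p (3 * t) := by
    intro t ht
    show (if t ≤ 1 / 2 then p (3 * t) else q (3 * t - 2)) = p (3 * t)
    by_cases h : t ≤ 1 / 2
    · rw [if_pos h]
    · rw [if_neg h, hq0 _ (by linarith), hp1 _ (by push Not at h; linarith)]
  have hright : ∀ t, (1 : ℝ) / 3 < t → r t = q (3 * t - 2) := by
    intro t ht
    show (if t ≤ 1 / 2 then p (3 * t) else q (3 * t - 2)) = q (3 * t - 2)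
    by_cases h : t ≤ 1 / 2
    · rw [if_pos h, hp1 _ (by linarith), hq0 _ (by linarith)]
    · rw [if_neg h]
  refine ⟨r, fun t => ?_, fun t ht => ?_, fun t ht => ?_, fun t => ?_⟩
  · -- smoothness, locally one of the two smooth pieces
    rcases lt_or_ge t (2 / 3) with ht | ht
    · have hev : r =ᶠ[𝓝 t] fun s => p (3 * s) := by
        filter_upwards [Iio_mem_nhds ht] with s hs using hleft s hs
      exact ((hp.comp (contDiff_const.mul contDiff_id).contMDiff) t).congr_of_eventuallyEq hev
    · have hev : r =ᶠ[𝓝 t] fun s => q (3 * s - 2) := by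
        filter_upwards [Ioi_mem_nhds (show (1 : ℝ) / 3 < t by linarith)] with s hs using hright s hs
      exact ((hq.comp ((contDiff_const.mul contDiff_id).sub contDiff_const).contMDiff) t).congr_of_eventuallyEq hev
  · rw [hleft t (by linarith)]; exact hp0 _ (by linarith)
  · rw [hright t (by linarith)]; exact hq1 _ (by linarith)
  · show (if t ≤ 1 / 2 then p (3 * t) else q (3 * t - 2)) ∈ O
    by_cases h : t ≤ 1 / 2
    · rw [if_pos h]; exact hpO _
    · rw [if_neg h]; exact hqO _

variable [IsManifold I ∞ M]

/-- **The local case: straight segments in a chart.**  If the trace on `range I` of the ball of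
radius `r` about `extChartAt I x x` lies in the chart target and is carried by the inverse
extended chart into `O`, then `x` is smoothly joined in `O` to every point of the corresponding
chart ball: the path is the chart image of the segment, reparametrised by
`Real.smoothTransition` (the segment stays in the convex set `ball ∩ range I`). [folklore] -/
theorem of_mem_extChartAt_ball {r : ℝ}
    (hball : ball (extChartAt I x x) r ∩ range I ⊆
      (extChartAt I x).target ∩ (extChartAt I x).symm ⁻¹' O)
    (hy : y ∈ (extChartAt I x).source) (hyr : extChartAt I x y ∈ ball (extChartAt I x x) r) :
    SmoothlyJoinedIn I O x y := by
  set e := extChartAt I x with he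
  set a : E := e x with ha
  set b : E := e y with hb
  set β : ℝ → ℝ := Real.smoothTransition with hβ
  set L : ℝ → E := fun t => a + β t • (b - a) with hL
  have hxs : x ∈ e.source := mem_extChartAt_source x
  have har : a ∈ ball a r ∩ range I := ⟨mem_ball_self (by
      have := hyr; rw [Metric.mem_ball] at this; linarith [dist_nonneg (x := e y) (y := a)]),
    extChartAt_target_subset_range x (e.map_source hxs)⟩
  have hbr : b ∈ ball a r ∩ range I := ⟨hyr, extChartAt_target_subset_range x (e.map_source hy)⟩
  have hconv : Convex ℝ (ball a r ∩ range I) := (convex_ball a r).inter I.convex_range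
  have hLmem : ∀ t, L t ∈ ball a r ∩ range I := fun t =>
    hconv.add_smul_sub_mem har hbr ⟨Real.smoothTransition.nonneg t, Real.smoothTransition.le_one t⟩
  have hLs : ContMDiff 𝓘(ℝ, ℝ) 𝓘(ℝ, E) ∞ L := by
    have : ContDiff ℝ ∞ L :=
      contDiff_const.add (Real.smoothTransition.contDiff.smul contDiff_const)
    exact this.contMDiff
  refine ⟨fun t => e.symm (L t), ?_, fun t ht => ?_, fun t ht => ?_, fun t => (hball (hLmem t)).2⟩
  · exact (contMDiffOn_extChartAt_symm x).comp_contMDiff hLs fun t => (hball (hLmem t)).1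
  · show e.symm (a + β t • (b - a)) = x
    rw [show β t = 0 from Real.smoothTransition.zero_of_nonpos ht, zero_smul, add_zero]
    exact e.left_inv hxs
  · show e.symm (a + β t • (b - a)) = y
    rw [show β t = 1 from Real.smoothTransition.one_of_one_le ht, one_smul, add_sub_cancel]
    exact e.left_inv hy

/-- **Classes of the relation are open**: every point `x` of an open set `O` has a neighbourhood
all of whose points are smoothly joined to `x` inside `O` (a chart ball about `x` mapped into
`O`). [folklore] -/
theorem exists_nhds_forall (hO : IsOpen O) (hx : x ∈ O) :
    ∃ N ∈ 𝓝 x, ∀ y ∈ N, SmoothlyJoinedIn I O x y := by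
  set e := extChartAt I x with he
  have h1 : e.target ∈ 𝓝[range I] e x := extChartAt_target_mem_nhdsWithin x
  obtain ⟨u, hu, huo, hxu⟩ : ∃ u, u ∩ range I ⊆ e.target ∧ IsOpen u ∧ e x ∈ u := by
    obtain ⟨u, huo, hxu, hu⟩ := mem_nhdsWithin.1 h1
    exact ⟨u, hu, huo, hxu⟩
  have h2 : e.symm ⁻¹' O ∈ 𝓝 (e x) :=
    (continuousAt_extChartAt_symm x).preimage_mem_nhds (by rw [extChartAt_to_inv]; exact hO.mem_nhds hx)
  obtain ⟨r, hr, hball⟩ : ∃ r > 0, ball (e x) r ⊆ u ∩ e.symm ⁻¹' O :=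
    Metric.mem_nhds_iff.1 (inter_mem (huo.mem_nhds hxu) h2)
  have hball' : ball (e x) r ∩ range I ⊆ e.target ∩ e.symm ⁻¹' O := fun z hz =>
    ⟨hu ⟨(hball hz.1).1, hz.2⟩, (hball hz.1).2⟩
  refine ⟨e.source ∩ e ⁻¹' ball (e x) r, ?_, fun y hy => of_mem_extChartAt_ball hball' hy.1 hy.2⟩
  exact inter_mem (extChartAt_source_mem_nhds x)
    ((continuousAt_extChartAt x).preimage_mem_nhds (isOpen_ball.mem_nhds (mem_ball_self hr)))

end SmoothlyJoinedIn

/-- **Two points of a preconnected open subset of a manifold are joined by a smooth path inside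
it** (constant near its ends).  Proof: the set of points of `O` smoothly joined to `x` and its
complement in `O` are both open (`SmoothlyJoinedIn.exists_nhds_forall` with transitivity and
symmetry), and the former contains `x`. [folklore] -/
theorem smoothlyJoinedIn_of_isPreconnected [IsManifold I ∞ M] {O : Set M} (hO : IsOpen O)
    (hconn : IsPreconnected O) {x y : M} (hx : x ∈ O) (hy : y ∈ O) : SmoothlyJoinedIn I O x y := by
  set u : Set M := {z | SmoothlyJoinedIn I O x z} with hu
  set v : Set M := {z | z ∈ O ∧ ¬ SmoothlyJoinedIn I O x z} with hv
  have huo : IsOpen u := by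
    refine isOpen_iff_mem_nhds.2 fun z hz => ?_
    obtain ⟨N, hN, hNj⟩ := SmoothlyJoinedIn.exists_nhds_forall (I := I) hO hz.mem_right
    exact mem_of_superset hN fun w hw => hz.trans (hNj w hw)
  have hvo : IsOpen v := by
    refine isOpen_iff_mem_nhds.2 fun z hz => ?_
    obtain ⟨N, hN, hNj⟩ := SmoothlyJoinedIn.exists_nhds_forall (I := I) hO hz.1
    refine mem_of_superset hN fun w hw => ⟨(hNj w hw).mem_right, fun hxw => hz.2 ?_⟩
    exact hxw.trans (hNj w hw).symm
  have hcover : O ⊆ u ∪ v := fun z hz => by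
    by_cases h : SmoothlyJoinedIn I O x z
    · exact Or.inl h
    · exact Or.inr ⟨hz, h⟩
  have hxu : (O ∩ u).Nonempty := ⟨x, hx, SmoothlyJoinedIn.refl hx⟩
  by_contra hxy
  have hyv : (O ∩ v).Nonempty := ⟨y, hy, hy, hxy⟩
  obtain ⟨z, -, hzu, hzv⟩ := hconn u v huo hvo hcover hxu hyv
  exact hzv.2 hzu

end SmoothPaths

end Literature.Topology.FourManifolds
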